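import Summits.CriticalPhenomena.PercolationContinuityZ3.Theorems.Transplant.PlanarSkeletonFrmFromDefs
import Summits.CriticalPhenomena.PercolationContinuityZ3.Theorems.Transplant.SkelFrmFromBChoiceAtQ3V
import Summits.CriticalPhenomena.PercolationContinuityZ3.Theorems.Transplant.SkelFrmBChoiceAtQ3V
import Summits.CriticalPhenomena.PercolationContinuityZ3.Theorems.Transplant.SkelFrmFromBChoiceKit
import Summits.CriticalPhenomena.PercolationContinuityZ3.Theorems.Transplant.SkelFrmBChoiceKit
import Summits.CriticalPhenomena.PercolationContinuityZ3.Theorems.Transplant.SkelFrmFromBChoiceZone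
import Summits.CriticalPhenomena.PercolationContinuityZ3.Theorems.Transplant.SkelFrmBChoiceZone
import Summits.CriticalPhenomena.PercolationContinuityZ3.Theorems.Transplant.SkelFrmFromBChoiceLinks
import Summits.CriticalPhenomena.PercolationContinuityZ3.Theorems.Transplant.SkelFrmBChoiceLinks
import HarnessLib
import Summits.CriticalPhenomena.PercolationContinuityZ3.Theorems.Transplant.SkelFrmBChoiceAtQV
/-!
# U-WAVE PORT (RULING D-U, lead g21 2026-08-26; WAVE-U-MANIFEST v3.0 row «SkelFrmBChoiceAtQV» ↦ «SkelFrmFromBChoiceAtQV») of the tree module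
# `Transplant/SkelFrmBChoiceAtQV` onto the carrier `PlanarSkeletonFrmFrom` (frames only, cylinders connected from width `ℓ₀` on)

ORIGINAL TITLE: N2 (frames-only node `SamePDropOfSkeletonFrm₁`, OPEN), WAVE 1 under (R-44)/(R-45): THE `AtQNQ` UNPACKINGS AT THE V CHOICES OF RECORD `NegB.choiceAtQ3V`

builds on p205010 (kernel theorem, internal audit signed; external expert review pending) — nothing in this file uses p205010; NOTHING is claimed about the
OPEN node U `SamePDropOfSkeletonFrmFrom₁` (nor U_s / the end state).  Lane `prim-bschramm`, seat `prim-hp-8 gen 53 (U-wave port pen, family P-hp8; tool of record = p3-g26 port_u.py)`; helper file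
(`--supports stmt-CriticalPhenomena-4575 --as helper`).  PORT RULES r1–r4 of RULING D-U: declaration order and proof texts are those of the original,
byte-identical except (i) the carrier token `PlanarSkeletonFrm ↦ PlanarSkeletonFrmFrom` (binders, `namespace`/`end` lines, qualified names of twinned
declarations), (ii) carrier-FREE declarations of the original (φ-level `Skelφ…` blocks and namespace-only arithmetic residents) are NOT re-declared —
this file imports the original and `export`s the twin-free residents (POLICY T / treatment (m1)); residents whose statement mentions a twinned
constant are copied, (iii) every carrier-binding declaration keeps its explicit binder `(Φ : PlanarSkeletonFrmFrom G)` in its own signature (r2).  Docstrings and citations are the original's.  Manifest row idx 95 (level 13; flags verbatim); filed by the hp-8 lineage under RULING M-11 (family P-hp8).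
-/

noncomputable section

open scoped Classical

namespace Summit.CriticalPhenomena.PercolationContinuityZ3.Theorems.Transplant

open MeasureTheory Literature.Probability.Percolation Literature.Probability.LatticeModels SimpleGraph KNCells KNLevels
open Literature.Barriers.CriticalPhenomena (HasExponentialGrowth graphBall)

namespace PlanarSkeletonFrmFrom

open SkelConc (Consts)
open BoxProdZ2 (ConcRadiiG)
open Skelφ (oriφ trφ)
open Skelφ.StepI (DataN DataNS OutNS famSign)

namespace NegB

open Neg

section AtQ

variable {κ : Consts} {V : Type} [DecidableEq V] [Countable V] {G : SimpleGraph V} [G.LocallyFinite] {Φ : PlanarSkeletonFrmFrom G} {t : V} {p : unitInterval}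
  {hC : Φ.CylSubcritical p} {gv fv : Neg.FSlot} {Pv : PSlot} {Sv : SSlot} {cv hv : CSlot} {bv : BSlot} {O : OutNS V} {q : unitInterval} (mk : ℕ)

/-! ## §1–§4 The twins -/

/-- (R-45) V twin at `choiceAtQ3V` (one-liner over the S lemma `factsNS_of_atQ`): `FactsNS`, the density window and Φ2 at `q` out of `AtQNQ`. [folklore] -/
theorem factsNS_of_atQV {κ : Consts} {V : Type} [DecidableEq V] [Countable V] {G : SimpleGraph V} [G.LocallyFinite] {Φ : PlanarSkeletonFrmFrom G} {t : V} {p : unitInterval} {hC : Φ.CylSubcritical p} {gv : Neg.FSlot} {fv : Neg.FSlot} {Pv : PSlot} {Sv : SSlot} {cv : CSlot} {hv : CSlot} {bv : BSlot} {O : OutNS V} {q : unitInterval} (hAt : (choiceAtQ3V κ Φ t p Pv gv fv Sv cv hv bv hC).AtQNQ O q) :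
    O.FactsNS (G := G) Φ.frame hC Neg.m₀ t ∧ (p : ℝ) / 2 ≤ q ∧ (q : ℝ) ≤ p ∧ Φ.CylSubcritical q :=
  factsNS_of_atQ (hAt := choiceAtQ3V_atQNQ_iff.1 hAt)

/-- (R-45) V twin at `choiceAtQ3V` (one-liner over the S lemma `shared_of_atQ`): The shared fields of `DT` and `D` out of `AtQNQ`. [folklore] -/
theorem shared_of_atQV {κ : Consts} {V : Type} [DecidableEq V] [Countable V] {G : SimpleGraph V} [G.LocallyFinite] {Φ : PlanarSkeletonFrmFrom G} {t : V} {p : unitInterval} {hC : Φ.CylSubcritical p} {gv : Neg.FSlot} {fv : Neg.FSlot} {Pv : PSlot} {Sv : SSlot} {cv : CSlot} {hv : CSlot} {bv : BSlot} {O : OutNS V} {q : unitInterval} (hAt : (choiceAtQ3V κ Φ t p Pv gv fv Sv cv hv bv hC).AtQNQ O q) :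
    O.DT.Λ = O.D.Λ ∧ O.DT.k = O.D.k ∧ O.DT.R = O.D.R ∧ O.DT.M₀ = O.D.M₀ ∧ O.DT.n₁ = O.D.n₁ :=
  shared_of_atQ (hAt := choiceAtQ3V_atQNQ_iff.1 hAt)

/-- (R-45) V twin at `choiceAtQ3V` (one-liner over the S lemma `clauses_of_atQ`): The oriented clauses at every admissible pair out of `AtQNQ`. [folklore] -/
theorem clauses_of_atQV {κ : Consts} {V : Type} [DecidableEq V] [Countable V] {G : SimpleGraph V} [G.LocallyFinite] {Φ : PlanarSkeletonFrmFrom G} {t : V} {p : unitInterval} {hC : Φ.CylSubcritical p} {gv : Neg.FSlot} {fv : Neg.FSlot} {Pv : PSlot} {Sv : SSlot} {cv : CSlot} {hv : CSlot} {bv : BSlot} {O : OutNS V} {q : unitInterval} (hAt : (choiceAtQ3V κ Φ t p Pv gv fv Sv cv hv bv hC).AtQNQ O q) :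
    ∀ M, O.D.M₀ ≤ M → ∀ n, O.D.n₁ M ≤ n →
      (O.ori t M n = true → O.D.EqGeom G Φ.φ t M n ∧ (O.D.hgt t M n).natAbs ≤ 10 * n) ∧
      (O.ori t M n = false → O.DT.EqGeom G (trφ Φ.φ) t M n ∧ (O.DT.hgt t M n).natAbs ≤ 10 * n) :=
  clauses_of_atQ (hAt := choiceAtQ3V_atQNQ_iff.1 hAt)

/-- (R-45) V twin at `choiceAtQ3V` (one-liner over the S lemma `eqNumL_of_atQ`): **The numeric long clause at the merged record** out of `AtQNQ`. [this work] -/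
theorem eqNumL_of_atQV {κ : Consts} {V : Type} [DecidableEq V] [Countable V] {G : SimpleGraph V} [G.LocallyFinite] {Φ : PlanarSkeletonFrmFrom G} {t : V} {p : unitInterval} {hC : Φ.CylSubcritical p} {gv : Neg.FSlot} {fv : Neg.FSlot} {Pv : PSlot} {Sv : SSlot} {cv : CSlot} {hv : CSlot} {bv : BSlot} {O : OutNS V} {q : unitInterval} (hAt : (choiceAtQ3V κ Φ t p Pv gv fv Sv cv hv bv hC).AtQNQ O q) :
    EqNumL κ Φ t p O.merged (gOf κ Φ t p O gv) (fOf κ Φ t p O fv) :=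
  eqNumL_of_atQ (hAt := choiceAtQ3V_atQNQ_iff.1 hAt)

/-- (R-45) V twin at `choiceAtQ3V` (one-liner over the S lemma `clauseL_of_atQ`): **The long clause (oriented map `φL`, `|h_L| ≤ 10 n_L`)** out of `AtQNQ`. [this work] -/
theorem clauseL_of_atQV {κ : Consts} {V : Type} [DecidableEq V] [Countable V] {G : SimpleGraph V} [G.LocallyFinite] {Φ : PlanarSkeletonFrmFrom G} {t : V} {p : unitInterval} {hC : Φ.CylSubcritical p} {gv : Neg.FSlot} {fv : Neg.FSlot} {Pv : PSlot} {Sv : SSlot} {cv : CSlot} {hv : CSlot} {bv : BSlot} {O : OutNS V} {q : unitInterval} (hAt : (choiceAtQ3V κ Φ t p Pv gv fv Sv cv hv bv hC).AtQNQ O q) :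
    O.merged.EqGeom G (φL κ Φ t p O.D O.DT.toDataN O.ori (gOf κ Φ t p O gv) (fOf κ Φ t p O fv)) t (ML κ Φ t p O.merged (gOf κ Φ t p O gv))
        (nL κ Φ t p O.merged (gOf κ Φ t p O gv) (fOf κ Φ t p O fv)) ∧
      (hL κ Φ t p O.merged (gOf κ Φ t p O gv) (fOf κ Φ t p O fv)).natAbs ≤ 10 * nL κ Φ t p O.merged (gOf κ Φ t p O gv) (fOf κ Φ t p O fv) :=
  clauseL_of_atQ (hAt := choiceAtQ3V_atQNQ_iff.1 hAt)

/-- (R-45) V twin at `choiceAtQ3V` (one-liner over the S lemma `clauseS_of_atQ`): **The short clause (oriented map `φS`, `|h_s| ≤ 10 n_s`)** out of `AtQNQ`. [this work] -/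
theorem clauseS_of_atQV {κ : Consts} {V : Type} [DecidableEq V] [Countable V] {G : SimpleGraph V} [G.LocallyFinite] {Φ : PlanarSkeletonFrmFrom G} {t : V} {p : unitInterval} {hC : Φ.CylSubcritical p} {gv : Neg.FSlot} {fv : Neg.FSlot} {Pv : PSlot} {Sv : SSlot} {cv : CSlot} {hv : CSlot} {bv : BSlot} {O : OutNS V} {q : unitInterval} (hAt : (choiceAtQ3V κ Φ t p Pv gv fv Sv cv hv bv hC).AtQNQ O q) :
    O.merged.EqGeom G (φS t O.D O.DT.toDataN O.ori (Φ := Φ)) t (Mu O.merged) (nS O.merged) ∧ (hS t O.merged).natAbs ≤ 10 * nS O.merged :=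
  clauseS_of_atQ (hAt := choiceAtQ3V_atQNQ_iff.1 hAt)

/-- (R-45) V twin at `choiceAtQ3V` (one-liner over the S lemma `clauseP_of_atQ`): **The clause of ANY admissible pair** (in particular every extra pair). [this work] -/
theorem clauseP_of_atQV {κ : Consts} {V : Type} [DecidableEq V] [Countable V] {G : SimpleGraph V} [G.LocallyFinite] {Φ : PlanarSkeletonFrmFrom G} {t : V} {p : unitInterval} {hC : Φ.CylSubcritical p} {gv : Neg.FSlot} {fv : Neg.FSlot} {Pv : PSlot} {Sv : SSlot} {cv : CSlot} {hv : CSlot} {bv : BSlot} {O : OutNS V} {q : unitInterval} (hAt : (choiceAtQ3V κ Φ t p Pv gv fv Sv cv hv bv hC).AtQNQ O q) {M n : ℕ} (hM : O.D.M₀ ≤ M) (hn : O.D.n₁ M ≤ n) :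
    O.merged.EqGeom G (oriφ Φ.φ (O.ori t M n)) t M n ∧ (O.merged.hgt t M n).natAbs ≤ 10 * n :=
  clauseP_of_atQ (hAt := choiceAtQ3V_atQNQ_iff.1 hAt) (hM := hM) (hn := hn)

/-- (R-45) V twin at `choiceAtQ3V` (one-liner over the S lemma `sgQ_sel_eq_one`): **At a SELECTED pair the served sign is `1`** (both families): `FactsNS`'s quadrant `(1, 1)`. [folklore] -/
theorem sgQ_sel_eq_oneV {κ : Consts} {V : Type} [DecidableEq V] [Countable V] {G : SimpleGraph V} [G.LocallyFinite] {Φ : PlanarSkeletonFrmFrom G} {t : V} {p : unitInterval} {hC : Φ.CylSubcritical p} {gv : Neg.FSlot} {fv : Neg.FSlot} {Pv : PSlot} {Sv : SSlot} {cv : CSlot} {hv : CSlot} {bv : BSlot} {O : OutNS V} {q : unitInterval} (hAt : (choiceAtQ3V κ Φ t p Pv gv fv Sv cv hv bv hC).AtQNQ O q) (M₁ N : ℕ) (fam : Fin 2) :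
    Skelφ.StepI.sgQ O.qd O.qdT O.ori t (O.D.sM M₁) (O.D.sN M₁ N) fam = 1 :=
  sgQ_sel_eq_one (hAt := choiceAtQ3V_atQNQ_iff.1 hAt) (M₁ := M₁) (N := N) (fam := fam)

/-- (R-45) V twin at `choiceAtQ3V` (one-liner over the S lemma `inputsP_of_atQ`): **THE PIECE-LINKS OF ANY LISTED PAIR at `q`, SERVED QUADRANT**: for `(M, n) ∈ SMnP`, family `fam`, far sign `τ`, the input at the oriented map over the merged
record with near sign `sgQ … t M n fam`, accuracy `δI3 = δkit³/16` ((R-33)). [this work] -/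
theorem inputsP_of_atQV {κ : Consts} {V : Type} [DecidableEq V] [Countable V] {G : SimpleGraph V} [G.LocallyFinite] {Φ : PlanarSkeletonFrmFrom G} {t : V} {p : unitInterval} {hC : Φ.CylSubcritical p} {gv : Neg.FSlot} {fv : Neg.FSlot} {Pv : PSlot} {Sv : SSlot} {cv : CSlot} {hv : CSlot} {bv : BSlot} {O : OutNS V} {q : unitInterval} (hAt : (choiceAtQ3V κ Φ t p Pv gv fv Sv cv hv bv hC).AtQNQ O q) {M n : ℕ}
    (hMn : (M, n) ∈ SMnP κ Φ t p O.merged (gOf κ Φ t p O gv) (fOf κ Φ t p O fv) Pv) (fam : Fin 2) (τ : ℤˣ) :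
    1 - δI3 κ Φ < (bondPercolation G q).real
      (Skelφ.StepI.eventN G (oriφ Φ.φ (O.ori t M n)) O.merged.toDataN (t, M, some (n, fam, Skelφ.StepI.sgQ O.qd O.qdT O.ori t M n fam, τ))) :=
  inputsP_of_atQ (hAt := choiceAtQ3V_atQNQ_iff.1 hAt) (hMn := hMn) (fam := fam) (τ := τ)

/-- (R-45) V twin at `choiceAtQ3V` (one-liner over the S lemma `inputsExtra_of_atQ`): **The extra pairs' piece-links** (served quadrant): for `(M, n) ∈ (Pv …).1`. [this work] -/
theorem inputsExtra_of_atQV {κ : Consts} {V : Type} [DecidableEq V] [Countable V] {G : SimpleGraph V} [G.LocallyFinite] {Φ : PlanarSkeletonFrmFrom G} {t : V} {p : unitInterval} {hC : Φ.CylSubcritical p} {gv : Neg.FSlot} {fv : Neg.FSlot} {Pv : PSlot} {Sv : SSlot} {cv : CSlot} {hv : CSlot} {bv : BSlot} {O : OutNS V} {q : unitInterval} (hAt : (choiceAtQ3V κ Φ t p Pv gv fv Sv cv hv bv hC).AtQNQ O q) {M n : ℕ} (hMn : (M, n) ∈ (Pv κ Φ t p O.merged).1) (fam : Fin 2) (τ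 : ℤˣ) :
    1 - δI3 κ Φ < (bondPercolation G q).real
      (Skelφ.StepI.eventN G (oriφ Φ.φ (O.ori t M n)) O.merged.toDataN (t, M, some (n, fam, Skelφ.StepI.sgQ O.qd O.qdT O.ori t M n fam, τ))) :=
  inputsExtra_of_atQ (hAt := choiceAtQ3V_atQNQ_iff.1 hAt) (hMn := hMn) (fam := fam) (τ := τ)

/-- (R-45) V twin at `choiceAtQ3V` (one-liner over the S lemma `inputsS_of_atQ`): **The short pair's piece-links, near sign `1`** (`φS = oriφ Φ.φ (ori t M_u n_s)`; the short pair is the selected pair at `D.M₀`). [this work] -/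
theorem inputsS_of_atQV {κ : Consts} {V : Type} [DecidableEq V] [Countable V] {G : SimpleGraph V} [G.LocallyFinite] {Φ : PlanarSkeletonFrmFrom G} {t : V} {p : unitInterval} {hC : Φ.CylSubcritical p} {gv : Neg.FSlot} {fv : Neg.FSlot} {Pv : PSlot} {Sv : SSlot} {cv : CSlot} {hv : CSlot} {bv : BSlot} {O : OutNS V} {q : unitInterval} (hAt : (choiceAtQ3V κ Φ t p Pv gv fv Sv cv hv bv hC).AtQNQ O q) (fam : Fin 2) (τ : ℤˣ) :
    1 - δI3 κ Φ < (bondPercolation G q).real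
      (Skelφ.StepI.eventN G (φS t O.D O.DT.toDataN O.ori (Φ := Φ)) O.merged.toDataN (t, Mu O.merged, some (nS O.merged, fam, 1, τ))) :=
  inputsS_of_atQ (hAt := choiceAtQ3V_atQNQ_iff.1 hAt) (fam := fam) (τ := τ)

/-- (R-45) V twin at `choiceAtQ3V` (one-liner over the S lemma `inputsL_of_atQ`): **The long pair's piece-links, near sign `1`** (`φL = oriφ Φ.φ (ori t M_L (n_L g f))`; the long pair is the selected pair at `max M_L g`). [this work] -/
theorem inputsL_of_atQV {κ : Consts} {V : Type} [DecidableEq V] [Countable V] {G : SimpleGraph V} [G.LocallyFinite] {Φ : PlanarSkeletonFrmFrom G} {t : V} {p : unitInterval} {hC : Φ.CylSubcritical p} {gv : Neg.FSlot} {fv : Neg.FSlot} {Pv : PSlot} {Sv : SSlot} {cv : CSlot} {hv : CSlot} {bv : BSlot} {O : OutNS V} {q : unitInterval} (hAt : (choiceAtQ3V κ Φ t p Pv gv fv Sv cv hv bv hC).AtQNQ O q) (fam : Fin 2) (τ : ℤˣ) :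
    1 - δI3 κ Φ < (bondPercolation G q).real
      (Skelφ.StepI.eventN G (φL κ Φ t p O.D O.DT.toDataN O.ori (gOf κ Φ t p O gv) (fOf κ Φ t p O fv)) O.merged.toDataN
        (t, ML κ Φ t p O.merged (gOf κ Φ t p O gv), some (nL κ Φ t p O.merged (gOf κ Φ t p O gv) (fOf κ Φ t p O fv), fam, 1, τ))) :=
  inputsL_of_atQ (hAt := choiceAtQ3V_atQNQ_iff.1 hAt) (fam := fam) (τ := τ)

/-- (R-45) V twin at `choiceAtQ3V` (one-liner over the S lemma `zone_of_atQ`): **The uniqueness zone at `M_u`** (as the merged record's zone input, any map). [this work] -/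
theorem zone_of_atQV {κ : Consts} {V : Type} [DecidableEq V] [Countable V] {G : SimpleGraph V} [G.LocallyFinite] {Φ : PlanarSkeletonFrmFrom G} {t : V} {p : unitInterval} {hC : Φ.CylSubcritical p} {gv : Neg.FSlot} {fv : Neg.FSlot} {Pv : PSlot} {Sv : SSlot} {cv : CSlot} {hv : CSlot} {bv : BSlot} {O : OutNS V} {q : unitInterval} (hAt : (choiceAtQ3V κ Φ t p Pv gv fv Sv cv hv bv hC).AtQNQ O q) :
    1 - δI3 κ Φ < (bondPercolation G q).real (Skelφ.StepI.eventN G (φS t O.D O.DT.toDataN O.ori (Φ := Φ)) O.merged.toDataN (t, Mu O.merged, none)) :=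
  zone_of_atQ (hAt := choiceAtQ3V_atQNQ_iff.1 hAt)

/-- (R-45) V twin at `choiceAtQ3V` (one-liner over the S lemma `inputsPAt_of_atQ`): **THE PIECE-LINKS OF ANY LISTED PAIR AT EVERY CENTRE `c`, SERVED QUADRANT** (`ChoiceNQ.inputsAt_of_atQNQ` at `choiceAtQ3`). [cite: KozmaNitzan2024, §4 pp. 19–21] -/
theorem inputsPAt_of_atQV {κ : Consts} {V : Type} [DecidableEq V] [Countable V] {G : SimpleGraph V} [G.LocallyFinite] {Φ : PlanarSkeletonFrmFrom G} {t : V} {p : unitInterval} {hC : Φ.CylSubcritical p} {gv : Neg.FSlot} {fv : Neg.FSlot} {Pv : PSlot} {Sv : SSlot} {cv : CSlot} {hv : CSlot} {bv : BSlot} {O : OutNS V} {q : unitInterval} (hAt : (choiceAtQ3V κ Φ t p Pv gv fv Sv cv hv bv hC).AtQNQ O q) (h1 : Φ.types = {t}) (c : V) {M n : ℕ}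
    (hMn : (M, n) ∈ SMnP κ Φ t p O.merged (gOf κ Φ t p O gv) (fOf κ Φ t p O fv) Pv) (fam : Fin 2) (τ : ℤˣ) :
    1 - δI3 κ Φ < (bondPercolation G q).real
      (Skelφ.StepI.eventNAt G (oriφ Φ.φ (O.ori t M n)) O.merged.toDataN t c (M, some (n, fam, Skelφ.StepI.sgQ O.qd O.qdT O.ori t M n fam, τ))) :=
  inputsPAt_of_atQ (hAt := choiceAtQ3V_atQNQ_iff.1 hAt) (h1 := h1) (c := c) (hMn := hMn) (fam := fam) (τ := τ)

/-- (R-45) V twin at `choiceAtQ3V` (one-liner over the S lemma `inputsExtraAt_of_atQ`): **The extra pairs' piece-links at every centre** (served quadrant). [this work] -/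
theorem inputsExtraAt_of_atQV {κ : Consts} {V : Type} [DecidableEq V] [Countable V] {G : SimpleGraph V} [G.LocallyFinite] {Φ : PlanarSkeletonFrmFrom G} {t : V} {p : unitInterval} {hC : Φ.CylSubcritical p} {gv : Neg.FSlot} {fv : Neg.FSlot} {Pv : PSlot} {Sv : SSlot} {cv : CSlot} {hv : CSlot} {bv : BSlot} {O : OutNS V} {q : unitInterval} (hAt : (choiceAtQ3V κ Φ t p Pv gv fv Sv cv hv bv hC).AtQNQ O q) (h1 : Φ.types = {t}) (c : V) {M n : ℕ} (hMn : (M, n) ∈ (Pv κ Φ t p O.merged).1)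
    (fam : Fin 2) (τ : ℤˣ) :
    1 - δI3 κ Φ < (bondPercolation G q).real
      (Skelφ.StepI.eventNAt G (oriφ Φ.φ (O.ori t M n)) O.merged.toDataN t c (M, some (n, fam, Skelφ.StepI.sgQ O.qd O.qdT O.ori t M n fam, τ))) :=
  inputsExtraAt_of_atQ (hAt := choiceAtQ3V_atQNQ_iff.1 hAt) (h1 := h1) (c := c) (hMn := hMn) (fam := fam) (τ := τ)

/-- (R-45) V twin at `choiceAtQ3V` (one-liner over the S lemma `inputsSAt_of_atQ`): **The short pair's piece-links at every centre, near sign `1`** (map `φS`). [cite: KozmaNitzan2024, §4 pp. 19–21] -/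
theorem inputsSAt_of_atQV {κ : Consts} {V : Type} [DecidableEq V] [Countable V] {G : SimpleGraph V} [G.LocallyFinite] {Φ : PlanarSkeletonFrmFrom G} {t : V} {p : unitInterval} {hC : Φ.CylSubcritical p} {gv : Neg.FSlot} {fv : Neg.FSlot} {Pv : PSlot} {Sv : SSlot} {cv : CSlot} {hv : CSlot} {bv : BSlot} {O : OutNS V} {q : unitInterval} (hAt : (choiceAtQ3V κ Φ t p Pv gv fv Sv cv hv bv hC).AtQNQ O q) (h1 : Φ.types = {t}) (c : V) (fam : Fin 2) (τ : ℤˣ) :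
    1 - δI3 κ Φ < (bondPercolation G q).real
      (Skelφ.StepI.eventNAt G (φS t O.D O.DT.toDataN O.ori (Φ := Φ)) O.merged.toDataN t c (Mu O.merged, some (nS O.merged, fam, 1, τ))) :=
  inputsSAt_of_atQ (hAt := choiceAtQ3V_atQNQ_iff.1 hAt) (h1 := h1) (c := c) (fam := fam) (τ := τ)

/-- (R-45) V twin at `choiceAtQ3V` (one-liner over the S lemma `inputsLAt_of_atQ`): **The long pair's piece-links at every centre, near sign `1`** (map `φL`). [cite: KozmaNitzan2024, §4 pp. 19–21] -/
theorem inputsLAt_of_atQV {κ : Consts} {V : Type} [DecidableEq V] [Countable V] {G : SimpleGraph V} [G.LocallyFinite] {Φ : PlanarSkeletonFrmFrom G} {t : V} {p : unitInterval} {hC : Φ.CylSubcritical p} {gv : Neg.FSlot} {fv : Neg.FSlot} {Pv : PSlot} {Sv : SSlot} {cv : CSlot} {hv : CSlot} {bv : BSlot} {O : OutNS V} {q : unitInterval} (hAt : (choiceAtQ3V κ Φ t p Pv gv fv Sv cv hv bv hC).AtQNQ O q) (h1 : Φ.types = {t}) (c : V) (fam : Fin 2) (τ : ℤˣ) :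
    1 - δI3 κ Φ < (bondPercolation G q).real
      (Skelφ.StepI.eventNAt G (φL κ Φ t p O.D O.DT.toDataN O.ori (gOf κ Φ t p O gv) (fOf κ Φ t p O fv)) O.merged.toDataN t c
        (ML κ Φ t p O.merged (gOf κ Φ t p O gv), some (nL κ Φ t p O.merged (gOf κ Φ t p O gv) (fOf κ Φ t p O fv), fam, 1, τ))) :=
  inputsLAt_of_atQ (hAt := choiceAtQ3V_atQNQ_iff.1 hAt) (h1 := h1) (c := c) (fam := fam) (τ := τ)

/-- (R-45) V twin at `choiceAtQ3V` (one-liner over the S lemma `zoneAt_of_atQ`): **The uniqueness zone at `M_u` AT EVERY CENTRE** (`UniqZone.zone G (O.merged.Λ c) O.merged.k M_u`; `UniqZone.zone` carries a `DecidableEq V` instance — the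
generic junction states it classically, this corollary at the section's instance, bridged by `convert`). [this work] -/
theorem zoneAt_of_atQV {κ : Consts} {V : Type} [DecidableEq V] [Countable V] {G : SimpleGraph V} [G.LocallyFinite] {Φ : PlanarSkeletonFrmFrom G} {t : V} {p : unitInterval} {hC : Φ.CylSubcritical p} {gv : Neg.FSlot} {fv : Neg.FSlot} {Pv : PSlot} {Sv : SSlot} {cv : CSlot} {hv : CSlot} {bv : BSlot} {O : OutNS V} {q : unitInterval} (hAt : (choiceAtQ3V κ Φ t p Pv gv fv Sv cv hv bv hC).AtQNQ O q) (h1 : Φ.types = {t}) (c : V) :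
    1 - δI3 κ Φ < (bondPercolation G q).real (UniqZone.zone G (O.merged.Λ c) O.merged.k (Mu O.merged)) :=
  zoneAt_of_atQ (hAt := choiceAtQ3V_atQNQ_iff.1 hAt) (h1 := h1) (c := c)

/-- (R-45) V twin at `choiceAtQ3V` (one-liner over the S lemma `clauseK_of_atQ`): **The kit pair's clause (map `φK`, `|h_kit| ≤ 10 n_kit`)** out of `AtQNQ`, any kit index `mk`. [this work] -/
theorem clauseK_of_atQV {κ : Consts} {V : Type} [DecidableEq V] [Countable V] {G : SimpleGraph V} [G.LocallyFinite] {Φ : PlanarSkeletonFrmFrom G} {t : V} {p : unitInterval} {hC : Φ.CylSubcritical p} {gv : Neg.FSlot} {fv : Neg.FSlot} {Pv : PSlot} {Sv : SSlot} {cv : CSlot} {hv : CSlot} {bv : BSlot} {O : OutNS V} {q : unitInterval} (mk : ℕ) (hAt : (choiceAtQ3V κ Φ t p Pv gv fv Sv cv hv bv hC).AtQNQ O q) :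
    O.merged.EqGeom G (KS.φK Φ t O.D O.DT.toDataN O.ori mk) t (KS.MK O.merged mk) (KS.nKit O.merged mk) ∧
      (KS.hKit t O.merged mk).natAbs ≤ 10 * KS.nKit O.merged mk :=
  clauseK_of_atQ (hAt := choiceAtQ3V_atQNQ_iff.1 hAt) (mk := mk)

/-- (R-45) V twin at `choiceAtQ3V` (one-liner over the S lemma `κK_int_of_atQ`): The ℤ form `|h_kit| ≤ 10·n_kit` (p1's `hκS`). [folklore] -/
theorem κK_int_of_atQV {κ : Consts} {V : Type} [DecidableEq V] [Countable V] {G : SimpleGraph V} [G.LocallyFinite] {Φ : PlanarSkeletonFrmFrom G} {t : V} {p : unitInterval} {hC : Φ.CylSubcritical p} {gv : Neg.FSlot} {fv : Neg.FSlot} {Pv : PSlot} {Sv : SSlot} {cv : CSlot} {hv : CSlot} {bv : BSlot} {O : OutNS V} {q : unitInterval} (mk : ℕ) (hAt : (choiceAtQ3V κ Φ t p Pv gv fv Sv cv hv bv hC).AtQNQ O q) :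
    |KS.hKit t O.merged mk| ≤ 10 * (KS.nKit O.merged mk : ℤ) :=
  κK_int_of_atQ (hAt := choiceAtQ3V_atQNQ_iff.1 hAt) (mk := mk)

/-- (R-45) V twin at `choiceAtQ3V` (one-liner over the S lemma `ℓKit_ge_of_atQ`): `24·M_u + 64 ≤ ℓ_kit` out of `AtQNQ`. [folklore] -/
theorem ℓKit_ge_of_atQV {κ : Consts} {V : Type} [DecidableEq V] [Countable V] {G : SimpleGraph V} [G.LocallyFinite] {Φ : PlanarSkeletonFrmFrom G} {t : V} {p : unitInterval} {hC : Φ.CylSubcritical p} {gv : Neg.FSlot} {fv : Neg.FSlot} {Pv : PSlot} {Sv : SSlot} {cv : CSlot} {hv : CSlot} {bv : BSlot} {O : OutNS V} {q : unitInterval} (mk : ℕ) (hAt : (choiceAtQ3V κ Φ t p Pv gv fv Sv cv hv bv hC).AtQNQ O q) :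
    24 * Mu O.merged + 64 ≤ KS.ℓKit t O.merged mk :=
  ℓKit_ge_of_atQ (hAt := choiceAtQ3V_atQNQ_iff.1 hAt) (mk := mk)

/-- (R-45) V twin at `choiceAtQ3V` (one-liner over the S lemma `hΛRg_of_atQ`): **`hΛRg`**: at `AtQNQ`, for every kit index `mk` and every centre `c`, the zone `Λ c M_u` of the merged record lies in the kit pair's prism `KS.RgK … mk φK c`.
[cite: KozmaNitzan2024, §4 p. 28 ((32): the zone inside the kit region)] -/
theorem hΛRg_of_atQV {κ : Consts} {V : Type} [DecidableEq V] [Countable V] {G : SimpleGraph V} [G.LocallyFinite] {Φ : PlanarSkeletonFrmFrom G} {t : V} {p : unitInterval} {hC : Φ.CylSubcritical p} {gv : Neg.FSlot} {fv : Neg.FSlot} {Pv : PSlot} {Sv : SSlot} {cv : CSlot} {hv : CSlot} {bv : BSlot} {O : OutNS V} {q : unitInterval} (mk : ℕ) (hAt : (choiceAtQ3V κ Φ t p Pv gv fv Sv cv hv bv hC).AtQNQ O q) :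
    ∀ c, O.merged.Λ c (Mu O.merged) ⊆ KS.RgK G t O.merged mk (KS.φK Φ t O.D O.DT.toDataN O.ori mk) c :=
  hΛRg_of_atQ (hAt := choiceAtQ3V_atQNQ_iff.1 hAt) (mk := mk)

/-- (R-45) V twin at `choiceAtQ3V` (one-liner over the S lemma `inputsLAt_cube_of_atQ`): **The long pair's piece-links at every centre at accuracy `1 − a³`** for any `a ≥ δkit` (e.g. `a := κ.δr 0` by `Neg.δkit_le_δr κ Φ (n := 0)`, `a := κ.δ₂` by
`Neg.δkit_le_δ₂`) — the shape the (R)/(C)/(F) kit clauses' `hlong` binders consume. [cite: KozmaNitzan2024, §4 pp. 19–21] -/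
theorem inputsLAt_cube_of_atQV {κ : Consts} {V : Type} [DecidableEq V] [Countable V] {G : SimpleGraph V} [G.LocallyFinite] {Φ : PlanarSkeletonFrmFrom G} {t : V} {p : unitInterval} {hC : Φ.CylSubcritical p} {gv : Neg.FSlot} {fv : Neg.FSlot} {Pv : PSlot} {Sv : SSlot} {cv : CSlot} {hv : CSlot} {bv : BSlot} {O : OutNS V} {q : unitInterval} (hAt : (choiceAtQ3V κ Φ t p Pv gv fv Sv cv hv bv hC).AtQNQ O q) (h1 : Φ.types = {t}) {a : ℝ} (ha : Neg.δkit κ Φ ≤ a) (c : V) (fam : Fin 2) (τ : ℤˣ) :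
    1 - a ^ 3 < (bondPercolation G q).real
      (Skelφ.StepI.eventNAt G (φL κ Φ t p O.D O.DT.toDataN O.ori (gOf κ Φ t p O gv) (fOf κ Φ t p O fv)) O.merged.toDataN t c
        (ML κ Φ t p O.merged (gOf κ Φ t p O gv), some (nL κ Φ t p O.merged (gOf κ Φ t p O gv) (fOf κ Φ t p O fv), fam, 1, τ))) :=
  inputsLAt_cube_of_atQ (hAt := choiceAtQ3V_atQNQ_iff.1 hAt) (h1 := h1) (ha := ha) (c := c) (fam := fam) (τ := τ)

/-- (R-45) V twin at `choiceAtQ3V` (one-liner over the S lemma `inputsSAt_cube_of_atQ`): **The short pair's piece-links at every centre at accuracy `1 − a³`** (`a ≥ δkit`). [cite: KozmaNitzan2024, §4 pp. 19–21] -/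
theorem inputsSAt_cube_of_atQV {κ : Consts} {V : Type} [DecidableEq V] [Countable V] {G : SimpleGraph V} [G.LocallyFinite] {Φ : PlanarSkeletonFrmFrom G} {t : V} {p : unitInterval} {hC : Φ.CylSubcritical p} {gv : Neg.FSlot} {fv : Neg.FSlot} {Pv : PSlot} {Sv : SSlot} {cv : CSlot} {hv : CSlot} {bv : BSlot} {O : OutNS V} {q : unitInterval} (hAt : (choiceAtQ3V κ Φ t p Pv gv fv Sv cv hv bv hC).AtQNQ O q) (h1 : Φ.types = {t}) {a : ℝ} (ha : Neg.δkit κ Φ ≤ a) (c : V) (fam : Fin 2) (τ : ℤˣ) :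
    1 - a ^ 3 < (bondPercolation G q).real
      (Skelφ.StepI.eventNAt G (φS t O.D O.DT.toDataN O.ori (Φ := Φ)) O.merged.toDataN t c (Mu O.merged, some (nS O.merged, fam, 1, τ))) :=
  inputsSAt_cube_of_atQ (hAt := choiceAtQ3V_atQNQ_iff.1 hAt) (h1 := h1) (ha := ha) (c := c) (fam := fam) (τ := τ)

/-- (R-45) V twin at `choiceAtQ3V` (one-liner over the S lemma `inputsPAt_cube_of_atQ`): **Any listed pair's piece-links at every centre at accuracy `1 − a³`** (`a ≥ δkit`; served near sign; in particular the kit pair when `(MK, nKit) ∈ Pv`).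
[cite: KozmaNitzan2024, §4 pp. 19–21] -/
theorem inputsPAt_cube_of_atQV {κ : Consts} {V : Type} [DecidableEq V] [Countable V] {G : SimpleGraph V} [G.LocallyFinite] {Φ : PlanarSkeletonFrmFrom G} {t : V} {p : unitInterval} {hC : Φ.CylSubcritical p} {gv : Neg.FSlot} {fv : Neg.FSlot} {Pv : PSlot} {Sv : SSlot} {cv : CSlot} {hv : CSlot} {bv : BSlot} {O : OutNS V} {q : unitInterval} (hAt : (choiceAtQ3V κ Φ t p Pv gv fv Sv cv hv bv hC).AtQNQ O q) (h1 : Φ.types = {t}) {a : ℝ} (ha : Neg.δkit κ Φ ≤ a) (c : V) {M n : ℕ}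
    (hMn : (M, n) ∈ SMnP κ Φ t p O.merged (gOf κ Φ t p O gv) (fOf κ Φ t p O fv) Pv) (fam : Fin 2) (τ : ℤˣ) :
    1 - a ^ 3 < (bondPercolation G q).real
      (Skelφ.StepI.eventNAt G (Skelφ.oriφ Φ.φ (O.ori t M n)) O.merged.toDataN t c (M, some (n, fam, Skelφ.StepI.sgQ O.qd O.qdT O.ori t M n fam, τ))) :=
  inputsPAt_cube_of_atQ (hAt := choiceAtQ3V_atQNQ_iff.1 hAt) (h1 := h1) (ha := ha) (c := c) (hMn := hMn) (fam := fam) (τ := τ)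

/-- (R-45) V twin at `choiceAtQ3V` (one-liner over the S lemma `zoneAt_cube_of_atQ`): **The zone at every centre at accuracy `1 − a³`** (`a ≥ δkit`). [this work] -/
theorem zoneAt_cube_of_atQV {κ : Consts} {V : Type} [DecidableEq V] [Countable V] {G : SimpleGraph V} [G.LocallyFinite] {Φ : PlanarSkeletonFrmFrom G} {t : V} {p : unitInterval} {hC : Φ.CylSubcritical p} {gv : Neg.FSlot} {fv : Neg.FSlot} {Pv : PSlot} {Sv : SSlot} {cv : CSlot} {hv : CSlot} {bv : BSlot} {O : OutNS V} {q : unitInterval} (hAt : (choiceAtQ3V κ Φ t p Pv gv fv Sv cv hv bv hC).AtQNQ O q) (h1 : Φ.types = {t}) {a : ℝ} (ha : Neg.δkit κ Φ ≤ a) (c : V) :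
    1 - a ^ 3 < (bondPercolation G q).real (UniqZone.zone G (O.merged.Λ c) O.merged.k (Mu O.merged)) :=
  zoneAt_cube_of_atQ (hAt := choiceAtQ3V_atQNQ_iff.1 hAt) (h1 := h1) (ha := ha) (c := c)

/-- (R-45) V twin at `choiceAtQ3V` (one-liner over the S lemma `hzconn_of_atQ`): **`hzconn`**: the `M_u`-zone is connected from its centre INSIDE ITSELF — `Λ c M_u = fatSeq c M_u = cylBall c M_u (fatRadius M_u)` and `pathIn_cylBall`. [folklore] -/
theorem hzconn_of_atQV {κ : Consts} {V : Type} [DecidableEq V] [Countable V] {G : SimpleGraph V} [G.LocallyFinite] {Φ : PlanarSkeletonFrmFrom G} {t : V} {p : unitInterval} {hC : Φ.CylSubcritical p} {gv : Neg.FSlot} {fv : Neg.FSlot} {Pv : PSlot} {Sv : SSlot} {cv : CSlot} {hv : CSlot} {bv : BSlot} {O : OutNS V} {q : unitInterval} (hAt : (choiceAtQ3V κ Φ t p Pv gv fv Sv cv hv bv hC).AtQNQ O q) :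
    ∀ c, ∀ s ∈ O.merged.Λ c (Mu O.merged), PathIn G (↑(O.merged.Λ c (Mu O.merged)) : Set V) c s :=
  hzconn_of_atQ (hAt := choiceAtQ3V_atQNQ_iff.1 hAt)

omit [DecidableEq V] in
/-- (R-45) V twin at `choiceAtQ3V` (one-liner over the S lemma `hkz_of_atQ`): **`hkz`** at `kz := M_u`: `1 ≤ M_u` (`1 ≤ k ≤ M₀ ≤ M_u`). [folklore] -/
theorem hkz_of_atQV {κ : Consts} {V : Type} [Countable V] {G : SimpleGraph V} [G.LocallyFinite] {Φ : PlanarSkeletonFrmFrom G} {t : V} {p : unitInterval} {hC : Φ.CylSubcritical p} {gv : Neg.FSlot} {fv : Neg.FSlot} {Pv : PSlot} {Sv : SSlot} {cv : CSlot} {hv : CSlot} {bv : BSlot} {O : OutNS V} {q : unitInterval} [DecidableEq V] (hAt : (choiceAtQ3V κ Φ t p Pv gv fv Sv cv hv bv hC).AtQNQ O q) :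
    1 ≤ Mu O.merged :=
  hkz_of_atQ (hAt := choiceAtQ3V_atQNQ_iff.1 hAt)

/-- (R-45) V twin at `choiceAtQ3V` (one-liner over the S lemma `hcz_of_atQ`): **`hcz`**: every centre lies in its own `M_u`-zone — `Λ c M_u = fatSeq c M_u ∋ c` (`self_mem_cylBall`); two-liner of p1-g17 (INBOX 2026-08-23T04:26:26Z,
farm-checked there), landed here with the other zone rows. [folklore] -/
theorem hcz_of_atQV {κ : Consts} {V : Type} [DecidableEq V] [Countable V] {G : SimpleGraph V} [G.LocallyFinite] {Φ : PlanarSkeletonFrmFrom G} {t : V} {p : unitInterval} {hC : Φ.CylSubcritical p} {gv : Neg.FSlot} {fv : Neg.FSlot} {Pv : PSlot} {Sv : SSlot} {cv : CSlot} {hv : CSlot} {bv : BSlot} {O : OutNS V} {q : unitInterval} (hAt : (choiceAtQ3V κ Φ t p Pv gv fv Sv cv hv bv hC).AtQNQ O q) (c : V) :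
    c ∈ O.merged.Λ c (Mu O.merged) :=
  hcz_of_atQ (hAt := choiceAtQ3V_atQNQ_iff.1 hAt) (c := c)

/-- (R-45) V twin at `choiceAtQ3V` (one-liner over the S lemma `hczAt_of_atQ`): **`hcz` at every level**: `c ∈ Λ c k` for all `k` (`Λ = fatSeq` at every level by `FactsO.seed`). [folklore] -/
theorem hczAt_of_atQV {κ : Consts} {V : Type} [DecidableEq V] [Countable V] {G : SimpleGraph V} [G.LocallyFinite] {Φ : PlanarSkeletonFrmFrom G} {t : V} {p : unitInterval} {hC : Φ.CylSubcritical p} {gv : Neg.FSlot} {fv : Neg.FSlot} {Pv : PSlot} {Sv : SSlot} {cv : CSlot} {hv : CSlot} {bv : BSlot} {O : OutNS V} {q : unitInterval} (hAt : (choiceAtQ3V κ Φ t p Pv gv fv Sv cv hv bv hC).AtQNQ O q) (c : V) (k : ℕ) :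
    c ∈ O.merged.Λ c k :=
  hczAt_of_atQ (hAt := choiceAtQ3V_atQNQ_iff.1 hAt) (c := c) (k := k)

/-- (R-45) V twin at `choiceAtQ3V` (one-liner over the S lemma `zone_k_subset_zone_Mu`): The zone at the seed level lies in the zone at `M_u` (nested fat seeds, `k ≤ M₀ ≤ M_u`). [folklore] -/
theorem zone_k_subset_zone_MuV {κ : Consts} {V : Type} [DecidableEq V] [Countable V] {G : SimpleGraph V} [G.LocallyFinite] {Φ : PlanarSkeletonFrmFrom G} {t : V} {p : unitInterval} {hC : Φ.CylSubcritical p} {gv : Neg.FSlot} {fv : Neg.FSlot} {Pv : PSlot} {Sv : SSlot} {cv : CSlot} {hv : CSlot} {bv : BSlot} {O : OutNS V} {q : unitInterval} (hAt : (choiceAtQ3V κ Φ t p Pv gv fv Sv cv hv bv hC).AtQNQ O q) (c : V) :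
    O.merged.Λ c O.merged.k ⊆ O.merged.Λ c (Mu O.merged) :=
  zone_k_subset_zone_Mu (hAt := choiceAtQ3V_atQNQ_iff.1 hAt) (c := c)

/-- (R-45) V twin at `choiceAtQ3V` (one-liner over the S lemma `hlong_of_atQ3`): **`hlong` AT EVERY CENTRE, LITERAL SHAPE**: the long pair's side-half links at accuracy `1 − a³` (`a ≥ δkit`), zone at `M_u`, served sign `σ = 1`.
[cite: KozmaNitzan2024, §4 pp. 19–21] -/
theorem hlong_of_atQ3V {κ : Consts} {V : Type} [DecidableEq V] [Countable V] {G : SimpleGraph V} [G.LocallyFinite] {Φ : PlanarSkeletonFrmFrom G} {t : V} {p : unitInterval} {hC : Φ.CylSubcritical p} {gv : Neg.FSlot} {fv : Neg.FSlot} {Pv : PSlot} {Sv : SSlot} {cv : CSlot} {hv : CSlot} {bv : BSlot} {O : OutNS V} {q : unitInterval} (hAt : (choiceAtQ3V κ Φ t p Pv gv fv Sv cv hv bv hC).AtQNQ O q) (h1 : Φ.types = {t}) {a : ℝ} (ha : Neg.δkit κ Φ ≤ a) :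
    ∀ (c : V) (τ : ℤ), τ = 1 ∨ τ = -1 → 1 - a ^ 3 < (bondPercolation G q).real
      (linkIn (Skelφ.pgramPrism G (φL κ Φ t p O.D O.DT.toDataN O.ori (gOf κ Φ t p O gv) (fOf κ Φ t p O fv)) c
          (nL κ Φ t p O.merged (gOf κ Φ t p O gv) (fOf κ Φ t p O fv)) (hL κ Φ t p O.merged (gOf κ Φ t p O gv) (fOf κ Φ t p O fv))
          (3 * ℓL κ Φ t p O.merged (gOf κ Φ t p O gv) (fOf κ Φ t p O fv)) (RL κ Φ t p O gv fv))
        (O.merged.Λ c (Mu O.merged))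
        (Skelφ.pgSideHalfW G (φL κ Φ t p O.D O.DT.toDataN O.ori (gOf κ Φ t p O gv) (fOf κ Φ t p O fv)) c
          (nL κ Φ t p O.merged (gOf κ Φ t p O gv) (fOf κ Φ t p O fv)) (hL κ Φ t p O.merged (gOf κ Φ t p O gv) (fOf κ Φ t p O fv))
          (ℓL κ Φ t p O.merged (gOf κ Φ t p O gv) (fOf κ Φ t p O fv)) (RL κ Φ t p O gv fv) 1 (1 * τ))) :=
  hlong_of_atQ3 (hAt := choiceAtQ3V_atQNQ_iff.1 hAt) (h1 := h1) (ha := ha)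

/-- (R-45) V twin at `choiceAtQ3V` (one-liner over the S lemma `hlongY_of_atQ3`): **`hlongY` AT EVERY CENTRE, LITERAL SHAPE**: the long pair's top-piece links at accuracy `1 − a³`, zone at `M_u`, served sign `σ = 1`, split point `vL`.
[cite: KozmaNitzan2024, §4 pp. 19–21] -/
theorem hlongY_of_atQ3V {κ : Consts} {V : Type} [DecidableEq V] [Countable V] {G : SimpleGraph V} [G.LocallyFinite] {Φ : PlanarSkeletonFrmFrom G} {t : V} {p : unitInterval} {hC : Φ.CylSubcritical p} {gv : Neg.FSlot} {fv : Neg.FSlot} {Pv : PSlot} {Sv : SSlot} {cv : CSlot} {hv : CSlot} {bv : BSlot} {O : OutNS V} {q : unitInterval} (hAt : (choiceAtQ3V κ Φ t p Pv gv fv Sv cv hv bv hC).AtQNQ O q) (h1 : Φ.types = {t}) {a : ℝ} (ha : Neg.δkit κ Φ ≤ a) :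
    ∀ (c : V) (τ : ℤ), τ = 1 ∨ τ = -1 → 1 - a ^ 3 < (bondPercolation G q).real
      (linkIn (Skelφ.pgramPrism G (φL κ Φ t p O.D O.DT.toDataN O.ori (gOf κ Φ t p O gv) (fOf κ Φ t p O fv)) c
          (nL κ Φ t p O.merged (gOf κ Φ t p O gv) (fOf κ Φ t p O fv)) (hL κ Φ t p O.merged (gOf κ Φ t p O gv) (fOf κ Φ t p O fv))
          (3 * ℓL κ Φ t p O.merged (gOf κ Φ t p O gv) (fOf κ Φ t p O fv)) (RL κ Φ t p O gv fv))
        (O.merged.Λ c (Mu O.merged))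
        (Skelφ.pgTopPieceW G (φL κ Φ t p O.D O.DT.toDataN O.ori (gOf κ Φ t p O gv) (fOf κ Φ t p O fv)) c
          (nL κ Φ t p O.merged (gOf κ Φ t p O gv) (fOf κ Φ t p O fv)) (hL κ Φ t p O.merged (gOf κ Φ t p O gv) (fOf κ Φ t p O fv))
          (ℓL κ Φ t p O.merged (gOf κ Φ t p O gv) (fOf κ Φ t p O fv)) (RL κ Φ t p O gv fv) 1 τ
          (vL κ Φ t p O.merged (gOf κ Φ t p O gv) (fOf κ Φ t p O fv)))) :=
  hlongY_of_atQ3 (hAt := choiceAtQ3V_atQNQ_iff.1 hAt) (h1 := h1) (ha := ha)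

end AtQ

end NegB

end PlanarSkeletonFrmFrom

end Summit.CriticalPhenomena.PercolationContinuityZ3.Theorems.Transplant

end
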